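import Summits.FinalStateConjecture.FinalStateConjecture.Theses.ZeroEnergyKerrOrBomb
import Literature.Geometry.Lorentzian.AxisymmetricBlackHoleUniqueness
import Literature.Geometry.Lorentzian.CausalityOpennessProofs
import Literature.Geometry.Lorentzian.LorentzianMetricProofs
import Literature.Geometry.Lorentzian.CauchyProblemCauchy
import Literature.Geometry.Manifold.OpenSubmanifoldMFDeriv

/-!
# Candidate proofs of `stub_kerrChartTransfer` and `stub_docIsometryTransfer`
(line `global-horizon-killing-field`, crux stmt-FinalStateConjecture-10690) — refuter evidence, NOT a landing.
Predicates copied verbatim from `Lines/global-horizon-killing-field.lean` (same names), so the two proof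
bodies transplant into the skeleton unchanged (plus the two extra imports
`Literature.Geometry.Lorentzian.CauchyProblemCauchy` (for `IsIsometricImmersion.comp`) and
`Literature.Geometry.Manifold.OpenSubmanifoldMFDeriv` (for `mfderiv_subtype_val`)).
-/

noncomputable section

namespace RefuterP45

open Set Literature.Geometry.Lorentzian Literature.Geometry.Manifold
open scoped Manifold ContDiff Topology

section Telescope
variable (𝓑 : StationaryAFBlackHole.{0})

def KerrConclusion [Kerr.Facts] : Prop :=
  ∃ (M a : ℝ), Kerr.IsSubextremal M a ∧ ∃ Ψ : Kerr.exterior M a → 𝓑.carrier,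
    Function.Injective Ψ ∧ Set.range Ψ = 𝓑.doc ∧
      PseudoRiemannianMetric.IsIsometricImmersion
        (Kerr.smoothMetric M a (Kerr.rPlus M a)).toPseudoRiemannianMetric
        𝓑.metric.toPseudoRiemannianMetric Ψ

theorem hF_holds : 𝓑.metric.isOpen_chronologicalFuture 𝓑.timeOrientation :=
  LorentzianMetric.isOpen_chronologicalFuture_holds_of_boundaryless
theorem hP_holds : 𝓑.metric.isOpen_chronologicalPast 𝓑.timeOrientation :=
  LorentzianMetric.isOpen_chronologicalPast_holds_of_boundaryless
theorem hres_holds :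
    PseudoRiemannianMetric.contMDiff_restrict (I := 𝓡 4) (n := (∞ : ℕ∞ω)) (M := 𝓑.carrier) :=
  PseudoRiemannianMetric.contMDiff_restrict_holds
def docOpens' : TopologicalSpace.Opens 𝓑.carrier := 𝓑.docOpens (hF_holds 𝓑) (hP_holds 𝓑)
end Telescope

def DocIsometry (𝓑' 𝓑 : StationaryAFBlackHole.{0}) : Prop :=
  ∃ Θ : docOpens' 𝓑' → 𝓑.carrier, Function.Injective Θ ∧ Set.range Θ = 𝓑.doc ∧
    PseudoRiemannianMetric.IsIsometricImmersion
      (𝓑'.metric.restrict (hres_holds 𝓑') (docOpens' 𝓑')).toPseudoRiemannianMetric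
      𝓑.metric.toPseudoRiemannianMetric Θ

/-- The inclusion of an open submanifold pulls the metric back to its restriction. -/
lemma pullbackBilin_subtype_val (𝓑 : StationaryAFBlackHole.{0})
    (hres : PseudoRiemannianMetric.contMDiff_restrict (I := 𝓡 4) (n := (∞ : ℕ∞ω)) (M := 𝓑.carrier))
    (U : TopologicalSpace.Opens 𝓑.carrier) :
    pullbackBilin (I := 𝓡 4) (I' := 𝓡 4) (Subtype.val : U → 𝓑.carrier) 𝓑.metric.val =
      (𝓑.metric.restrict hres U).val := by
  funext x
  ext v w
  rw [pullbackBilin_apply, OpenSubmanifold.mfderiv_subtype_val]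
  rfl

/-- **stub 4** (candidate proof). -/
theorem stub_kerrChartTransfer :
    ∀ (𝓑 : StationaryAFBlackHole.{0}) [𝓑.metric.HasLeviCivita] [Kerr.Facts]
      (hF : 𝓑.metric.isOpen_chronologicalFuture 𝓑.timeOrientation)
      (hP : 𝓑.metric.isOpen_chronologicalPast 𝓑.timeOrientation)
      (hres : PseudoRiemannianMetric.contMDiff_restrict (I := 𝓡 4) (n := (∞ : ℕ∞ω))
        (M := 𝓑.carrier)),
      𝓑.IsIsometricToKerrExterior hF hP hres → KerrConclusion 𝓑 := by
  intro 𝓑 _ _ hF hP hres h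
  -- `Kerr.exterior` is a plain `def` for `Kerr.region a r₊`; unfold it FIRST so that the types of
  -- `Φ` (stated with `exterior`) and of the Kerr metric (living on `region a r₊`) agree at
  -- instance transparency (otherwise `ChartedSpace E4 ↥(Kerr.exterior M a)` fails to synthesise
  -- in every mixed term and `rw` motives are ill-typed).
  unfold StationaryAFBlackHole.IsIsometricToKerrExterior Kerr.exterior at h
  unfold KerrConclusion Kerr.exterior
  obtain ⟨M, a, hMa, Φ, hΦ⟩ := h
  refine ⟨M, a, hMa, Subtype.val ∘ Φ.symm, ?_, ?_, ?_, ?_⟩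
  · exact Subtype.val_injective.comp Φ.symm.injective
  · ext p
    constructor
    · rintro ⟨x, rfl⟩
      exact (Φ.symm x).2
    · intro hp
      refine ⟨Φ ⟨p, hp⟩, ?_⟩
      show (Φ.symm (Φ ⟨p, hp⟩)).val = p
      rw [Φ.symm_apply_apply]
  · exact contMDiff_subtype_val.comp Φ.symm.contMDiff
  · intro y
    have hval : MDifferentiable (𝓡 4) (𝓡 4) (Subtype.val : 𝓑.docOpens hF hP → 𝓑.carrier) :=
      (contMDiff_subtype_val (n := ∞)).mdifferentiable (by simp)
    have hsymm : MDifferentiable 𝓘(ℝ, E4) (𝓡 4) Φ.symm := Φ.symm.mdifferentiable (by simp)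
    have hΦd : MDifferentiable (𝓡 4) 𝓘(ℝ, E4) Φ := Φ.mdifferentiable (by simp)
    have hrestr := funext fun z ↦ (hΦ z).symm
    have hid : ((Φ : 𝓑.docOpens hF hP → Kerr.region a (Kerr.rPlus M a)) ∘ Φ.symm) = id :=
      funext fun x ↦ Φ.apply_symm_apply x
    rw [pullbackBilin_comp hval hsymm, pullbackBilin_subtype_val 𝓑 hres]
    change pullbackBilin (I := 𝓡 4) (I' := 𝓘(ℝ, E4)) Φ.symm
        (𝓑.metric.restrict hres (𝓑.docOpens hF hP)).toPseudoRiemannianMetric.val y = _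
    rw [hrestr, ← pullbackBilin_comp hΦd hsymm, hid, pullbackBilin_id]

/-- **stub 5** (candidate proof). -/
theorem stub_docIsometryTransfer :
    ∀ (𝓑 𝓑' : StationaryAFBlackHole.{0}) [𝓑.metric.HasLeviCivita] [𝓑'.metric.HasLeviCivita]
      [Kerr.Facts], DocIsometry 𝓑' 𝓑 → KerrConclusion 𝓑' → KerrConclusion 𝓑 := by
  intro 𝓑 𝓑' _ _ _ hΘ h'
  unfold KerrConclusion Kerr.exterior at h' ⊢   -- see the comment in `stub_kerrChartTransfer`
  obtain ⟨Θ, hΘinj, hΘrange, hΘiso⟩ := hΘ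
  obtain ⟨M, a, hMa, Ψ', hΨinj, hΨrange, hΨiso⟩ := h'
  have hmem : ∀ x, Ψ' x ∈ docOpens' 𝓑' := fun x ↦
    show Ψ' x ∈ 𝓑'.doc from hΨrange ▸ Set.mem_range_self x
  let Ψ'' : Kerr.region a (Kerr.rPlus M a) → docOpens' 𝓑' := fun x ↦ ⟨Ψ' x, hmem x⟩
  have hval : ∀ x, (Ψ'' x : 𝓑'.carrier) = Ψ' x := fun _ ↦ rfl
  have hsurj : Function.Surjective Ψ'' := by
    intro u
    have hu : (u : 𝓑'.carrier) ∈ Set.range Ψ' := hΨrange ▸ u.2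
    obtain ⟨x, hx⟩ := hu
    exact ⟨x, Subtype.ext hx⟩
  have hsm : ContMDiff 𝓘(ℝ, E4) (𝓡 4) ∞ Ψ'' :=
    (ContMDiff.subtypeVal_comp_iff (docOpens' 𝓑') Ψ'').mp hΨiso.1
  have hΨ''iso : PseudoRiemannianMetric.IsIsometricImmersion
      (Kerr.smoothMetric M a (Kerr.rPlus M a)).toPseudoRiemannianMetric
      (𝓑'.metric.restrict (hres_holds 𝓑') (docOpens' 𝓑')).toPseudoRiemannianMetric Ψ'' := by
    refine ⟨hsm, fun y ↦ ?_⟩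
    have hd : mfderiv 𝓘(ℝ, E4) (𝓡 4) (Subtype.val ∘ Ψ'') y = mfderiv 𝓘(ℝ, E4) (𝓡 4) Ψ'' y := by
      rw [mfderiv_comp y
        (OpenSubmanifold.mdifferentiableAt_subtype_val (I := 𝓡 4) (U := docOpens' 𝓑') (Ψ'' y))
        (hsm.mdifferentiableAt (by simp)),
        OpenSubmanifold.mfderiv_subtype_val (I := 𝓡 4) (U := docOpens' 𝓑')]
      exact ContinuousLinearMap.id_comp _
    have h2 := hΨiso.2 y
    ext v w
    have h2' := congrArg (fun B ↦ B v w) h2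
    simp only [pullbackBilin_apply] at h2' ⊢
    change 𝓑'.metric.val (Ψ' y) (mfderiv 𝓘(ℝ, E4) (𝓡 4) (Subtype.val ∘ Ψ'') y v)
      (mfderiv 𝓘(ℝ, E4) (𝓡 4) (Subtype.val ∘ Ψ'') y w) = _ at h2'
    rw [hd] at h2'
    exact h2'
  refine ⟨M, a, hMa, Θ ∘ Ψ'', ?_, ?_, hΘiso.comp hΨ''iso⟩
  · exact hΘinj.comp fun x y hxy ↦ hΨinj (congrArg Subtype.val hxy)
  · rw [Set.range_comp, hsurj.range_eq, Set.image_univ, hΘrange]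

end RefuterP45
end
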